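import Literature.Probability.LatticeModels.PSCornerEncoding
import Literature.Probability.LatticeModels.IsingModel
import HarnessLib

/-!
# Lattice geometry of `ℤ^d` for contour arguments: sup-balls, coordinate boxes, lines and their
# exits, oriented edges and the nearest-neighbour Hamiltonian as a sum over oriented edges

Topic `Probability/LatticeModels` (pure combinatorics of `ℤ^d`). Elementary facts used by
Peierls / Pirogov–Sinai-type contour arguments with thick contours (Friedli–Velenik 2017, §7.2):

* `supBall r x = {y : ‖x - y‖_∞ ≤ r}` (an order interval of `Fin d → ℤ`), its cardinality
  `(2r+1)^d`, `★`-connectedness of order intervals (`starConn_Icc`);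
* the coordinate box of two points and the **exit lemma** `exists_adj_exit`: between a point of a
  set and a point outside it there is a nearest-neighbour boundary step inside their coordinate box;
* for a `★`-connected finite `S`: two points of `S`, and a point of the hull and a point of `S`, are
  at sup-distance `≤ |S| - 1` (`supDist_le_card_sub_one_of_not_mem_starExt`), so that
  `S ⊆ supBall (|S|-1) x` for every `x` in the hull (the anchoring of contours at a site);
* **lines and exits**: in direction `i`, a finite set has at least as many forward (backward)
  exits `x ∈ M, x ± eᵢ ∉ M` as it meets lines (`card_image_lineKey_le_card_fwdExits`) — the
  trivial isoperimetry "every line through the set leaves it";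
* **oriented edges**: every edge of `ℤ^d` is `{x, x + eᵢ}` for a unique `(x, i)`; sums over
  `edgesTouching (zdGraph d) X` become sums over `oedges X = {(x,i) : x ∈ X ∨ x + eᵢ ∈ X}`
  (`sum_edgesTouching_eq_sum_oedges`), in particular the zero-field Hamiltonian
  (`isingHamiltonian_zdGraph_eq_neg_sum_oedges`), and such sums localise to the sites where the
  summand lives (`sum_oedges_eq_sum_oedges_of_subset`).

Everything is proved; no named facts.

## References

* S. Friedli, Y. Velenik, *Statistical Mechanics of Lattice Systems*, CUP 2017, §3.1 (the
  Hamiltonian as a sum over nearest-neighbour edges), §7.2 (thick contours, `d_∞`), App. B.15.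
  [FriedliVelenik2017]
-/

noncomputable section

open Finset Relation

namespace Literature.Probability.LatticeModels

variable {d : ℕ}

/-! ### Unit vectors, translations, the sup-distance -/

/-- The unit coordinate vector `eᵢ`. [cite: FriedliVelenik2017, §3.1] -/
abbrev uvec (i : Fin d) : Site d := Pi.single i 1

/-- `eᵢ` at a coordinate. [folklore] -/
theorem uvec_apply (i j : Fin d) : (uvec i : Site d) j = if j = i then 1 else 0 := by
  simp [uvec, Pi.single_apply]

/-- `x ∼ x + eᵢ`. [cite: FriedliVelenik2017, §3.1] -/
theorem zdGraph_adj_add_uvec (x : Site d) (i : Fin d) : (zdGraph d).Adj x (x + uvec i) :=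
  (zdGraph_adj_iff _ _).2 ⟨i, Or.inl rfl⟩

/-- `x - eᵢ ∼ x`. [cite: FriedliVelenik2017, §3.1] -/
theorem zdGraph_adj_sub_uvec (x : Site d) (i : Fin d) : (zdGraph d).Adj (x - uvec i) x :=
  (zdGraph_adj_iff _ _).2 ⟨i, Or.inl (by rw [sub_add_cancel])⟩

/-- `x ∼ x - eᵢ`. [cite: FriedliVelenik2017, §3.1] -/
theorem zdGraph_adj_sub_uvec' (x : Site d) (i : Fin d) : (zdGraph d).Adj x (x - uvec i) :=
  (zdGraph_adj_sub_uvec x i).symm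

/-- Every edge of `ℤ^d` is `{x, x+eᵢ}`: an adjacent pair is `(x, x + eᵢ)` or `(x + eᵢ, x)`.
[cite: FriedliVelenik2017, §3.1] -/
theorem exists_uvec_of_adj {x y : Site d} (h : (zdGraph d).Adj x y) :
    ∃ i, y = x + uvec i ∨ x = y + uvec i :=
  (zdGraph_adj_iff x y).1 h

/-- Adjacency is translation invariant. [cite: FriedliVelenik2017, §3.1] -/
theorem zdGraph_adj_add_right_iff {x y : Site d} (v : Site d) :
    (zdGraph d).Adj (x + v) (y + v) ↔ (zdGraph d).Adj x y := by
  rw [zdGraph_adj_iff, zdGraph_adj_iff]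
  refine exists_congr fun i => ?_
  constructor
  · rintro (h | h)
    · left; exact add_right_cancel (h.trans (add_right_comm x v _))
    · right; exact add_right_cancel (h.trans (add_right_comm y v _))
  · rintro (h | h)
    · left; rw [h]; abel
    · right; rw [h]; abel

/-- Adjacency is translation invariant (subtraction). [cite: FriedliVelenik2017, §3.1] -/
theorem zdGraph_adj_sub_right_iff {x y : Site d} (v : Site d) :
    (zdGraph d).Adj (x - v) (y - v) ↔ (zdGraph d).Adj x y := by
  rw [sub_eq_add_neg, sub_eq_add_neg, zdGraph_adj_add_right_iff]

/-- The sup-distance is translation invariant. [cite: FriedliVelenik2017, App. B.15] -/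
theorem supDist_add_right (x y v : Site d) : supDist (x + v) (y + v) = supDist x y := by
  unfold supDist
  congr 1
  funext i
  simp

/-- The sup-distance is translation invariant (subtraction). [cite: FriedliVelenik2017, App. B.15] -/
theorem supDist_sub_right (x y v : Site d) : supDist (x - v) (y - v) = supDist x y := by
  rw [sub_eq_add_neg, sub_eq_add_neg, supDist_add_right]

/-- Triangle inequality for the sup-distance. [cite: FriedliVelenik2017, App. B.15] -/
theorem supDist_triangle (x y z : Site d) : supDist x z ≤ supDist x y + supDist y z := by
  refine supDist_le_iff.2 fun i => ?_
  have h1 := natAbs_sub_le_supDist x y i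
  have h2 := natAbs_sub_le_supDist y z i
  omega

/-- Nearest neighbours are at sup-distance `≤ 1`. [cite: FriedliVelenik2017, App. B.15] -/
theorem supDist_le_one_of_adj {x y : Site d} (h : (zdGraph d).Adj x y) : supDist x y ≤ 1 :=
  (zdStar_adj.1 (zdGraph_le_zdStar h)).2

/-- `‖x - (x + eᵢ)‖_∞ ≤ 1`. [folklore] -/
theorem supDist_add_uvec_le (x : Site d) (i : Fin d) : supDist x (x + uvec i) ≤ 1 :=
  supDist_le_one_of_adj (zdGraph_adj_add_uvec x i)

/-- A coordinate bound from a sup-distance bound. [folklore] -/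
theorem abs_sub_le_of_supDist_le {x y : Site d} {n : ℕ} (h : supDist x y ≤ n) (i : Fin d) :
    -(n : ℤ) ≤ x i - y i ∧ x i - y i ≤ n := by
  have := (supDist_le_iff.1 h) i
  omega

/-- A sup-distance bound from coordinate bounds. [folklore] -/
theorem supDist_le_of_forall {x y : Site d} {n : ℕ} (h : ∀ i, -(n : ℤ) ≤ x i - y i ∧ x i - y i ≤ n) :
    supDist x y ≤ n :=
  supDist_le_iff.2 fun i => by have := h i; omega

/-! ### Sup-balls and order intervals -/

/-- **The sup-ball** `{y : ‖x - y‖_∞ ≤ r}` of radius `r` about `x`, as the order interval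
`[x - r, x + r]` of `Fin d → ℤ` (for `r = 1` this is `starBall x`).
[cite: FriedliVelenik2017, §7.2.1 (the d_∞-balls of thick contours)] -/
def supBall (r : ℕ) (x : Site d) : Finset (Site d) := Finset.Icc (x - fun _ => (r : ℤ)) (x + fun _ => (r : ℤ))

/-- Membership in a sup-ball. [cite: FriedliVelenik2017, §7.2.1] -/
theorem mem_supBall {r : ℕ} {x y : Site d} : y ∈ supBall r x ↔ supDist x y ≤ r := by
  rw [supBall, Finset.mem_Icc, supDist_le_iff, Pi.le_def, Pi.le_def, ← forall_and]
  refine forall_congr' fun i => ?_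
  simp only [Pi.sub_apply, Pi.add_apply]
  omega

/-- The centre belongs to its ball. [folklore] -/
theorem mem_supBall_self (r : ℕ) (x : Site d) : x ∈ supBall r x := mem_supBall.2 (by simp)

/-- Symmetry of ball membership. [folklore] -/
theorem mem_supBall_comm {r : ℕ} {x y : Site d} : y ∈ supBall r x ↔ x ∈ supBall r y := by
  rw [mem_supBall, mem_supBall, supDist_comm]

/-- Balls grow with the radius. [folklore] -/
theorem supBall_mono {r r' : ℕ} (h : r ≤ r') (x : Site d) : supBall r x ⊆ supBall r' x := fun _ hy =>
  mem_supBall.2 ((mem_supBall.1 hy).trans h)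

/-- `starBall = supBall 1`. [cite: FriedliVelenik2017, App. B.15] -/
theorem starBall_eq_supBall (x : Site d) : starBall x = supBall 1 x := by
  ext y; rw [mem_starBall, mem_supBall]

/-- `|supBall r x| = (2r+1)^d`. [cite: FriedliVelenik2017, §7.2.1] -/
theorem card_supBall (r : ℕ) (x : Site d) : #(supBall r x) = (2 * r + 1) ^ d := by
  rw [supBall, Pi.card_Icc]
  simp only [Pi.sub_apply, Pi.add_apply, Int.card_Icc]
  have h : ∀ j, (x j + r + 1 - (x j - r)).toNat = 2 * r + 1 := fun j => by omega
  simp only [h, Finset.prod_const, Finset.card_univ, Fintype.card_fin]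

/-- A translate of a ball is the ball about the translate. [folklore] -/
theorem mem_supBall_add_iff {r : ℕ} {x y v : Site d} : y + v ∈ supBall r (x + v) ↔ y ∈ supBall r x := by
  rw [mem_supBall, mem_supBall, supDist_add_right]

/-- `y - v ∈ supBall r x ↔ y ∈ supBall r (x + v)`. [folklore] -/
theorem sub_mem_supBall_iff {r : ℕ} {x y v : Site d} : y - v ∈ supBall r x ↔ y ∈ supBall r (x + v) := by
  rw [← mem_supBall_add_iff (v := v), sub_add_cancel]

/-- **Order intervals of `ℤ^d` are `★`-connected** (indeed nearest-neighbour connected): move one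
coordinate at a time. [cite: FriedliVelenik2017, App. B.15] -/
theorem starConn_Icc (a b : Site d) : StarConn ((Finset.Icc a b : Finset (Site d)) : Set (Site d)) := by
  intro x hx y hy
  rw [mem_coe, Finset.mem_Icc] at hx hy
  -- induction on the number of coordinates where `z` and `y` differ
  suffices key : ∀ (n : ℕ) (z : Site d), a ≤ z → z ≤ b → #(univ.filter fun k => z k ≠ y k) ≤ n →
      ReflTransGen (starRel ((Finset.Icc a b : Finset (Site d)) : Set (Site d))) z y from
    key d x hx.1 hx.2 ((card_filter_le _ _).trans (by simp))
  intro n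
  induction n with
  | zero =>
    intro z _ _ hn
    have : z = y := funext fun k => by
      by_contra hk
      have : 0 < #(univ.filter fun k => z k ≠ y k) := card_pos.2 ⟨k, mem_filter.2 ⟨mem_univ k, hk⟩⟩
      omega
    subst this
    exact ReflTransGen.refl
  | succ n ih =>
    intro z hza hzb hn
    by_cases hall : ∀ k, z k = y k
    · rw [show z = y from funext hall]
    · push Not at hall
      obtain ⟨k, hk⟩ := hall
      have hmem : ∀ w : ℤ, min (z k) (y k) ≤ w → w ≤ max (z k) (y k) →
          Function.update z k w ∈ ((Finset.Icc a b : Finset (Site d)) : Set (Site d)) := by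
        intro w hw1 hw2
        rw [mem_coe, Finset.mem_Icc]
        have hak : a k ≤ z k := hza k
        have hbk : z k ≤ b k := hzb k
        have hayk : a k ≤ y k := hy.1 k
        have hbyk : y k ≤ b k := hy.2 k
        refine ⟨fun j => ?_, fun j => ?_⟩
        · by_cases hj : j = k
          · rw [hj, Function.update_self]; exact (le_min hak hayk).trans hw1
          · rw [Function.update_of_ne hj]; exact hza j
        · by_cases hj : j = k
          · rw [hj, Function.update_self]; exact hw2.trans (max_le hbk hbyk)
          · rw [Function.update_of_ne hj]; exact hzb j
      have hmove : ReflTransGen (starRel ((Finset.Icc a b : Finset (Site d)) : Set (Site d))) z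
          (Function.update z k (y k)) := by
        rcases le_or_gt (z k) (y k) with hle | hlt
        · obtain ⟨m, hm⟩ := Int.le.dest hle
          rw [← hm]
          refine reflTransGen_update_add z k m fun j hj => hmem _ ?_ ?_
          · rw [min_eq_left hle]; omega
          · rw [max_eq_right hle]; omega
        · obtain ⟨m, hm⟩ := Int.le.dest hlt.le
          rw [show y k = z k - m by omega]
          refine reflTransGen_update_sub z k m fun j hj => hmem _ ?_ ?_
          · rw [min_eq_right hlt.le]; omega
          · rw [max_eq_left hlt.le]; omega
      have hza' : a ≤ Function.update z k (y k) := fun j => by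
        by_cases hj : j = k
        · subst hj; rw [Function.update_self]; exact hy.1 j
        · rw [Function.update_of_ne hj]; exact hza j
      have hzb' : Function.update z k (y k) ≤ b := fun j => by
        by_cases hj : j = k
        · subst hj; rw [Function.update_self]; exact hy.2 j
        · rw [Function.update_of_ne hj]; exact hzb j
      refine hmove.trans (ih _ hza' hzb' ?_)
      have hset : (univ.filter fun k' => Function.update z k (y k) k' ≠ y k') =
          (univ.filter fun k' => z k' ≠ y k').erase k := by
        ext k'
        simp only [mem_filter, mem_univ, true_and, mem_erase]
        by_cases hk' : k' = k
        · subst hk'; simp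
        · rw [Function.update_of_ne hk']; tauto
      rw [hset, card_erase_of_mem (mem_filter.2 ⟨mem_univ k, hk⟩)]
      omega

/-- Sup-balls are `★`-connected. [cite: FriedliVelenik2017, §7.2.1] -/
theorem starConn_supBall (r : ℕ) (x : Site d) : StarConn (supBall r x : Set (Site d)) :=
  starConn_Icc _ _

/-- The intersection of two sup-balls is `★`-connected (an order interval). [cite: FriedliVelenik2017, §7.2.1] -/
theorem starConn_supBall_inter (r : ℕ) (x y : Site d) : StarConn ((supBall r x ∩ supBall r y : Finset (Site d)) : Set (Site d)) := by
  have h : supBall r x ∩ supBall r y =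
      Finset.Icc ((x - fun _ => (r : ℤ)) ⊔ (y - fun _ => (r : ℤ))) ((x + fun _ => (r : ℤ)) ⊓ (y + fun _ => (r : ℤ))) := by
    ext z
    simp only [mem_inter, supBall, Finset.mem_Icc, sup_le_iff, le_inf_iff]
    tauto
  rw [h]
  exact starConn_Icc _ _

/-! ### The coordinate box of two points and the exit lemma -/

/-- The coordinate box spanned by two points. [folklore] -/
def cbox (u y : Site d) : Set (Site d) := {z | ∀ i, min (u i) (y i) ≤ z i ∧ z i ≤ max (u i) (y i)}

/-- The endpoints lie in their coordinate box. [folklore] -/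
theorem left_mem_cbox (u y : Site d) : u ∈ cbox u y := fun _ => ⟨min_le_left _ _, le_max_left _ _⟩

/-- The endpoints lie in their coordinate box. [folklore] -/
theorem right_mem_cbox (u y : Site d) : y ∈ cbox u y := fun _ => ⟨min_le_right _ _, le_max_right _ _⟩

/-- A point of the coordinate box is sup-close to both endpoints. [folklore] -/
theorem supDist_le_of_mem_cbox {u y z : Site d} (hz : z ∈ cbox u y) :
    supDist u z ≤ supDist u y ∧ supDist z y ≤ supDist u y := by
  constructor
  · refine supDist_le_iff.2 fun i => ?_
    have h1 := natAbs_sub_le_supDist u y i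
    obtain ⟨h2, h3⟩ := hz i
    omega
  · refine supDist_le_iff.2 fun i => ?_
    have h1 := natAbs_sub_le_supDist u y i
    obtain ⟨h2, h3⟩ := hz i
    omega

/-- Boxes are nested along a monotone approach. [folklore] -/
theorem cbox_subset_of_mem {u u' y : Site d} (hu' : u' ∈ cbox u y) : cbox u' y ⊆ cbox u y := by
  intro z hz i
  obtain ⟨h1, h2⟩ := hu' i
  obtain ⟨h3, h4⟩ := hz i
  constructor <;> omega

/-- The `ℓ¹`-distance of two lattice points, as a natural number. [folklore] -/
def latL1Dist (u y : Site d) : ℕ := ∑ i, (u i - y i).natAbs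

/-- Points at `ℓ¹`-distance `0` coincide. [folklore] -/
theorem eq_of_latL1Dist_eq_zero {u y : Site d} (h : latL1Dist u y = 0) : u = y := by
  funext i
  have := (Finset.sum_eq_zero_iff.1 h) i (mem_univ i)
  omega

/-- **One monotone step**: from `u ≠ y` there is a nearest neighbour `u'` of `u` in the coordinate
box of `u, y`, strictly `ℓ¹`-closer to `y`. [folklore] -/
theorem exists_step_towards {u y : Site d} (h : u ≠ y) :
    ∃ u', (zdGraph d).Adj u u' ∧ u' ∈ cbox u y ∧ latL1Dist u' y < latL1Dist u y := by
  obtain ⟨i, hi⟩ : ∃ i, u i ≠ y i := by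
    by_contra hall
    push Not at hall
    exact h (funext hall)
  rcases lt_or_gt_of_ne hi with hlt | hgt
  · refine ⟨u + uvec i, zdGraph_adj_add_uvec u i, fun j => ?_, ?_⟩
    · rw [Pi.add_apply, uvec_apply]
      by_cases hj : j = i
      · rw [if_pos hj, hj]; omega
      · rw [if_neg hj]; omega
    · unfold latL1Dist
      refine sum_lt_sum (fun j _ => ?_) ⟨i, mem_univ i, ?_⟩
      · rw [Pi.add_apply, uvec_apply]
        by_cases hj : j = i
        · rw [if_pos hj, hj]; omega
        · rw [if_neg hj]; omega
      · rw [Pi.add_apply, uvec_apply, if_pos rfl]; omega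
  · refine ⟨u - uvec i, zdGraph_adj_sub_uvec' u i, fun j => ?_, ?_⟩
    · rw [Pi.sub_apply, uvec_apply]
      by_cases hj : j = i
      · rw [if_pos hj, hj]; omega
      · rw [if_neg hj]; omega
    · unfold latL1Dist
      refine sum_lt_sum (fun j _ => ?_) ⟨i, mem_univ i, ?_⟩
      · rw [Pi.sub_apply, uvec_apply]
        by_cases hj : j = i
        · rw [if_pos hj, hj]; omega
        · rw [if_neg hj]; omega
      · rw [Pi.sub_apply, uvec_apply, if_pos rfl]; omega

/-- **The exit lemma**: from a point `u` of a set `A` to a point `y ∉ A` there is a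
nearest-neighbour step `v ∼ v'` with `v ∈ A`, `v' ∉ A`, both in the coordinate box of `u, y` (the
first exit of a monotone lattice path). [folklore] -/
theorem exists_adj_exit (A : Set (Site d)) {u y : Site d} (hu : u ∈ A) (hy : y ∉ A) :
    ∃ v v', v ∈ A ∧ v' ∉ A ∧ (zdGraph d).Adj v v' ∧ v ∈ cbox u y ∧ v' ∈ cbox u y := by
  suffices key : ∀ (n : ℕ) (u : Site d), u ∈ A → latL1Dist u y ≤ n →
      ∃ v v', v ∈ A ∧ v' ∉ A ∧ (zdGraph d).Adj v v' ∧ v ∈ cbox u y ∧ v' ∈ cbox u y from key _ u hu le_rfl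
  intro n
  induction n with
  | zero =>
    intro u hu hn
    exact absurd hu (by rw [eq_of_latL1Dist_eq_zero (Nat.le_zero.1 hn)]; exact hy)
  | succ n ih =>
    intro u hu hn
    have hne : u ≠ y := fun h => hy (h ▸ hu)
    obtain ⟨u', hadj, hu'box, hlt⟩ := exists_step_towards hne
    by_cases hu'A : u' ∈ A
    · obtain ⟨v, v', hv, hv', hvv', hvbox, hv'box⟩ := ih u' hu'A (by omega)
      exact ⟨v, v', hv, hv', hvv', cbox_subset_of_mem hu'box hvbox, cbox_subset_of_mem hu'box hv'box⟩
    · exact ⟨u, u', hu, hu'A, hadj, left_mem_cbox u y, hu'box⟩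

/-! ### `★`-connected sets: coordinate spread, and where the hull lies -/

/-- **The coordinate spread of a `★`-connected set is less than its cardinality**: all the values
between two attained values of a coordinate are attained (discrete intermediate value theorem).
[cite: FriedliVelenik2017, §7.4.3 (|hull| ≤ |supp|^d)] -/
theorem sub_le_card_sub_one_of_starConn {S : Finset (Site d)} (hS : StarConn (S : Set (Site d))) (i : Fin d)
    {a b : Site d} (ha : a ∈ S) (hb : b ∈ S) : b i - a i ≤ (#S : ℤ) - 1 := by
  rcases le_or_gt (a i) (b i) with hab | hab
  · -- the values `a i, …, b i` are attained by distinct points of `S`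
    obtain ⟨n, hn⟩ := Int.le.dest hab
    have hsub : ∀ m : ℕ, m ≤ n → ∃ z ∈ S, z i = a i + m := fun m hm =>
      exists_apply_eq_of_starConn hS i ha hb (by omega) (by omega)
    choose f hf using hsub
    have hcard : n + 1 ≤ #S := by
      have := Finset.card_le_card_of_injOn (s := (univ : Finset (Fin (n + 1)))) (t := S)
        (fun m : Fin (n + 1) => f m.1 (Nat.lt_succ_iff.1 m.2))
        (fun m _ => (hf m.1 (Nat.lt_succ_iff.1 m.2)).1) (fun m _ m' _ hmm' => by
          have h1 := (hf m.1 (Nat.lt_succ_iff.1 m.2)).2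
          have h2 := (hf m'.1 (Nat.lt_succ_iff.1 m'.2)).2
          simp only at hmm'
          rw [hmm'] at h1
          exact Fin.ext (by omega))
      simpa using this
    omega
  · have : 0 < #S := card_pos.2 ⟨a, ha⟩
    omega

/-- Two points of a `★`-connected finite set are at sup-distance `≤ |S| - 1`. [cite: FriedliVelenik2017, §7.4.3] -/
theorem supDist_le_card_sub_one_of_starConn {S : Finset (Site d)} (hS : StarConn (S : Set (Site d)))
    {a b : Site d} (ha : a ∈ S) (hb : b ∈ S) : supDist a b ≤ #S - 1 := by
  have hpos : 0 < #S := card_pos.2 ⟨a, ha⟩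
  refine supDist_le_iff.2 fun i => ?_
  have h1 := sub_le_card_sub_one_of_starConn hS i ha hb
  have h2 := sub_le_card_sub_one_of_starConn hS i hb ha
  omega

/-- **A point of the hull of a `★`-connected finite set is within sup-distance `|S| - 1` of every
point of the set**: outside the coordinate box of `S` one is in the exterior
(`mem_starExt_of_forall_lt/gt`), and the box has sides `≤ |S| - 1`.
[cite: FriedliVelenik2017, §7.2.6 and §7.4.3] -/
theorem supDist_le_card_sub_one_of_not_mem_starExt (hd : 2 ≤ d) {S : Finset (Site d)}
    (hS : StarConn (S : Set (Site d))) {x : Site d} (hx : x ∉ starExt S) {s : Site d} (hs : s ∈ S) :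
    supDist x s ≤ #S - 1 := by
  have hpos : 0 < #S := card_pos.2 ⟨s, hs⟩
  refine supDist_le_iff.2 fun i => ?_
  -- some point of `S` is at least `x i`, some point at most `x i`, in coordinate `i`
  obtain ⟨a, ha, hax⟩ : ∃ a ∈ S, a i ≤ x i := by
    by_contra h
    push Not at h
    exact hx (mem_starExt_of_forall_gt hd i h)
  obtain ⟨b, hb, hxb⟩ : ∃ b ∈ S, x i ≤ b i := by
    by_contra h
    push Not at h
    exact hx (mem_starExt_of_forall_lt hd i h)
  have h1 := sub_le_card_sub_one_of_starConn hS i ha hs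
  have h2 := sub_le_card_sub_one_of_starConn hS i hs hb
  omega

/-- Hence a `★`-connected finite `S` lies in the ball of radius `|S| - 1` about any point of its
hull (any point not in its exterior). [cite: FriedliVelenik2017, §7.2.6 and §7.4.3] -/
theorem subset_supBall_of_not_mem_starExt (hd : 2 ≤ d) {S : Finset (Site d)}
    (hS : StarConn (S : Set (Site d))) {x : Site d} (hx : x ∉ starExt S) : S ⊆ supBall (#S - 1) x :=
  fun _ hs => mem_supBall.2 (supDist_le_card_sub_one_of_not_mem_starExt hd hS hx hs)

/-! ### Lines and exits -/

/-- The line through `x` in direction `i`, labelled by the point of the line with `i`-th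
coordinate `0`. [folklore] -/
def lineKey (i : Fin d) (x : Site d) : Site d := Function.update x i 0

/-- Points of the same line differ only in coordinate `i`. [folklore] -/
theorem lineKey_eq_iff {i : Fin d} {x y : Site d} : lineKey i x = lineKey i y ↔ ∀ j, j ≠ i → x j = y j := by
  constructor
  · intro h j hj
    have := congrFun h j
    rwa [lineKey, lineKey, Function.update_of_ne hj, Function.update_of_ne hj] at this
  · intro h
    funext j
    by_cases hj : j = i
    · subst hj; simp [lineKey]
    · rw [lineKey, lineKey, Function.update_of_ne hj, Function.update_of_ne hj, h j hj]

/-- Steps in direction `i` stay on the line. [folklore] -/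
theorem lineKey_add_uvec (i : Fin d) (x : Site d) : lineKey i (x + uvec i) = lineKey i x :=
  lineKey_eq_iff.2 fun j hj => by rw [Pi.add_apply, uvec_apply, if_neg hj, add_zero]

/-- Steps in direction `-i` stay on the line. [folklore] -/
theorem lineKey_sub_uvec (i : Fin d) (x : Site d) : lineKey i (x - uvec i) = lineKey i x :=
  lineKey_eq_iff.2 fun j hj => by rw [Pi.sub_apply, uvec_apply, if_neg hj, sub_zero]

/-- **Forward exits** of a finite set in direction `i`: points `x ∈ M` with `x + eᵢ ∉ M`. [folklore] -/
def fwdExits (M : Finset (Site d)) (i : Fin d) : Finset (Site d) := M.filter fun x => x + uvec i ∉ M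

/-- **Backward exits** of a finite set in direction `i`: points `x ∈ M` with `x - eᵢ ∉ M`. [folklore] -/
def bwdExits (M : Finset (Site d)) (i : Fin d) : Finset (Site d) := M.filter fun x => x - uvec i ∉ M

/-- Membership in `fwdExits`. [folklore] -/
theorem mem_fwdExits {M : Finset (Site d)} {i : Fin d} {x : Site d} : x ∈ fwdExits M i ↔ x ∈ M ∧ x + uvec i ∉ M := by
  rw [fwdExits, mem_filter]

/-- Membership in `bwdExits`. [folklore] -/
theorem mem_bwdExits {M : Finset (Site d)} {i : Fin d} {x : Site d} : x ∈ bwdExits M i ↔ x ∈ M ∧ x - uvec i ∉ M := by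
  rw [bwdExits, mem_filter]

/-- **Every line met by `M` carries a forward exit**: the point of `M` on the line with the largest
`i`-th coordinate. Hence `M` has at least as many forward exits in direction `i` as it meets
lines. [folklore] -/
theorem card_image_lineKey_le_card_fwdExits (M : Finset (Site d)) (i : Fin d) :
    #(M.image (lineKey i)) ≤ #(fwdExits M i) := by
  classical
  -- on each line choose the point of `M` with maximal `i`-coordinate
  have hex : ∀ ℓ ∈ M.image (lineKey i), ∃ x ∈ fwdExits M i, lineKey i x = ℓ := by
    intro ℓ hℓ
    have hne : (M.filter fun x => lineKey i x = ℓ).Nonempty := by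
      obtain ⟨x, hx, rfl⟩ := mem_image.1 hℓ
      exact ⟨x, mem_filter.2 ⟨hx, rfl⟩⟩
    obtain ⟨x, hx, hmax⟩ := exists_max_image _ (fun x : Site d => x i) hne
    obtain ⟨hxM, hxℓ⟩ := mem_filter.1 hx
    refine ⟨x, mem_fwdExits.2 ⟨hxM, fun h => ?_⟩, hxℓ⟩
    have := hmax (x + uvec i) (mem_filter.2 ⟨h, by rw [lineKey_add_uvec, hxℓ]⟩)
    rw [Pi.add_apply, uvec_apply, if_pos rfl] at this
    omega
  choose f hf using hex
  calc #(M.image (lineKey i)) = #((M.image (lineKey i)).attach) := (card_attach).symm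
    _ ≤ #(fwdExits M i) := card_le_card_of_injOn (fun ℓ => f ℓ.1 ℓ.2) (fun ℓ _ => (hf ℓ.1 ℓ.2).1)
        (fun ℓ _ ℓ' _ h => Subtype.ext (by rw [← (hf ℓ.1 ℓ.2).2, ← (hf ℓ'.1 ℓ'.2).2]; exact congrArg _ h))

/-- Every line met by `M` carries a backward exit. [folklore] -/
theorem card_image_lineKey_le_card_bwdExits (M : Finset (Site d)) (i : Fin d) :
    #(M.image (lineKey i)) ≤ #(bwdExits M i) := by
  classical
  have hex : ∀ ℓ ∈ M.image (lineKey i), ∃ x ∈ bwdExits M i, lineKey i x = ℓ := by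
    intro ℓ hℓ
    have hne : (M.filter fun x => lineKey i x = ℓ).Nonempty := by
      obtain ⟨x, hx, rfl⟩ := mem_image.1 hℓ
      exact ⟨x, mem_filter.2 ⟨hx, rfl⟩⟩
    obtain ⟨x, hx, hmin⟩ := exists_min_image _ (fun x : Site d => x i) hne
    obtain ⟨hxM, hxℓ⟩ := mem_filter.1 hx
    refine ⟨x, mem_bwdExits.2 ⟨hxM, fun h => ?_⟩, hxℓ⟩
    have := hmin (x - uvec i) (mem_filter.2 ⟨h, by rw [lineKey_sub_uvec, hxℓ]⟩)
    rw [Pi.sub_apply, uvec_apply, if_pos rfl] at this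
    omega
  choose f hf using hex
  calc #(M.image (lineKey i)) = #((M.image (lineKey i)).attach) := (card_attach).symm
    _ ≤ #(bwdExits M i) := card_le_card_of_injOn (fun ℓ => f ℓ.1 ℓ.2) (fun ℓ _ => (hf ℓ.1 ℓ.2).1)
        (fun ℓ _ ℓ' _ h => Subtype.ext (by rw [← (hf ℓ.1 ℓ.2).2, ← (hf ℓ'.1 ℓ'.2).2]; exact congrArg _ h))

/-! ### Oriented edges of `ℤ^d` and the Hamiltonian -/

/-- **The oriented edges touching `X`**: pairs `(x, i)` (standing for the edge `{x, x + eᵢ}`) with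
`x ∈ X` or `x + eᵢ ∈ X`. [cite: FriedliVelenik2017, §3.1 (ℰ^b_Λ)] -/
def oedges (X : Finset (Site d)) : Finset (Site d × Fin d) :=
  (X ×ˢ univ) ∪ univ.biUnion fun i => (X.image fun y => y - uvec i) ×ˢ {i}

/-- Membership in `oedges`. [cite: FriedliVelenik2017, §3.1] -/
theorem mem_oedges {X : Finset (Site d)} {p : Site d × Fin d} : p ∈ oedges X ↔ p.1 ∈ X ∨ p.1 + uvec p.2 ∈ X := by
  rw [oedges, mem_union, mem_product, mem_biUnion]
  simp only [mem_univ, and_true, true_and, mem_product, mem_image, mem_singleton]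
  constructor
  · rintro (h | ⟨i, ⟨y, hy, hyp⟩, rfl⟩)
    · exact Or.inl h
    · right; rwa [← hyp, sub_add_cancel]
  · rintro (h | h)
    · exact Or.inl h
    · exact Or.inr ⟨p.2, ⟨p.1 + uvec p.2, h, by rw [add_sub_cancel_right]⟩, rfl⟩

/-- `oedges` is monotone. [folklore] -/
theorem oedges_mono {X Y : Finset (Site d)} (h : X ⊆ Y) : oedges X ⊆ oedges Y := fun p hp => by
  rw [mem_oedges] at hp ⊢
  exact hp.imp (fun h' => h h') (fun h' => h h')

/-- The edge `{x, x + eᵢ}` of an oriented edge. [cite: FriedliVelenik2017, §3.1] -/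
def oedgeToSym2 (p : Site d × Fin d) : Sym2 (Site d) := s(p.1, p.1 + uvec p.2)

/-- `eᵢ ≠ 0`. [folklore] -/
theorem uvec_ne_zero (i : Fin d) : (uvec i : Site d) ≠ 0 := by
  intro h
  have := congrFun h i
  simp [uvec] at this

/-- `eᵢ + eⱼ ≠ 0`. [folklore] -/
theorem uvec_add_uvec_ne_zero (i j : Fin d) : (uvec i : Site d) + uvec j ≠ 0 := by
  intro h
  have := congrFun h i
  simp only [Pi.add_apply, uvec_apply, Pi.zero_apply] at this
  split_ifs at this <;> omega

/-- `eᵢ = eⱼ` only if `i = j`. [folklore] -/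
theorem uvec_injective : Function.Injective (uvec : Fin d → Site d) := by
  intro i j h
  by_contra hij
  have := congrFun h i
  simp [uvec, hij] at this

/-- **Every edge of `ℤ^d` is `{x, x+eᵢ}` for a unique oriented edge.** [cite: FriedliVelenik2017, §3.1] -/
theorem oedgeToSym2_injective : Function.Injective (oedgeToSym2 (d := d)) := by
  rintro ⟨x, i⟩ ⟨y, j⟩ h
  have h' : (x = y ∧ x + uvec i = y + uvec j) ∨ (x = y + uvec j ∧ x + uvec i = y) := by
    simpa [oedgeToSym2] using h
  rcases h' with ⟨h1, h2⟩ | ⟨h1, h2⟩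
  · subst h1
    have : uvec i = uvec j := add_left_cancel h2
    rw [uvec_injective this]
  · exfalso
    rw [h1, add_assoc] at h2
    have : (uvec j : Site d) + uvec i = 0 := add_left_cancel (h2.trans (add_zero y).symm)
    exact uvec_add_uvec_ne_zero j i this

/-- The edges touching `X` are the images of the oriented edges touching `X`. [cite: FriedliVelenik2017, §3.1] -/
theorem edgesTouching_zdGraph_eq_image (X : Finset (Site d)) :
    edgesTouching (zdGraph d) X = (oedges X).image oedgeToSym2 := by
  ext e
  rw [mem_edgesTouching_iff, mem_image]
  constructor
  · rintro ⟨he, x, hxX, hxe⟩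
    induction e using Sym2.ind with
    | h a c =>
      have hadj : (zdGraph d).Adj a c := by simpa using he
      obtain ⟨i, hi | hi⟩ := exists_uvec_of_adj hadj
      · refine ⟨(a, i), mem_oedges.2 ?_, by rw [oedgeToSym2, hi]⟩
        rcases Sym2.mem_iff.1 hxe with rfl | rfl
        · exact Or.inl hxX
        · right; rwa [← hi]
      · refine ⟨(c, i), mem_oedges.2 ?_, by rw [oedgeToSym2, ← hi, Sym2.eq_swap]⟩
        rcases Sym2.mem_iff.1 hxe with rfl | rfl
        · right; rwa [← hi]
        · exact Or.inl hxX
  · rintro ⟨⟨x, i⟩, hp, rfl⟩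
    refine ⟨?_, ?_⟩
    · simpa [oedgeToSym2] using zdGraph_adj_add_uvec x i
    · rcases mem_oedges.1 hp with h | h
      · exact ⟨x, h, by simp [oedgeToSym2]⟩
      · exact ⟨x + uvec i, h, by simp [oedgeToSym2]⟩

/-- **Sums over the edges touching `X` are sums over oriented edges.** [cite: FriedliVelenik2017, §3.1, eq. (3.6)] -/
theorem sum_edgesTouching_eq_sum_oedges {M : Type*} [AddCommMonoid M] (X : Finset (Site d)) (f : Sym2 (Site d) → M) :
    ∑ e ∈ edgesTouching (zdGraph d) X, f e = ∑ p ∈ oedges X, f s(p.1, p.1 + uvec p.2) := by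
  rw [edgesTouching_zdGraph_eq_image, sum_image fun p _ q _ h => oedgeToSym2_injective h]
  rfl

/-- **The zero-field nearest-neighbour Hamiltonian on `ℤ^d` as a sum over oriented edges**:
`H^η_{Λ;0}(σ) = -∑_{(x,i) : x ∈ Λ ∨ x+eᵢ ∈ Λ} σ_x σ_{x+eᵢ}`. [cite: FriedliVelenik2017, §3.1, eqs. (3.2), (3.6)] -/
theorem isingHamiltonian_zdGraph_eq_neg_sum_oedges (Λ : Finset (Site d)) (η σ : SpinConfig (Site d)) :
    isingHamiltonian (zdGraph d) Λ 0 (.fixed η) σ = -∑ p ∈ oedges Λ, spinAt p.1 σ * spinAt (p.1 + uvec p.2) σ := by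
  rw [isingHamiltonian, interactionEdges_fixed, zero_mul, sub_zero, sum_edgesTouching_eq_sum_oedges]
  simp only [bondSpin_mk]

/-- **Localisation of oriented-edge sums**: if a summand vanishes on the oriented edges both of
whose endpoints avoid `D ⊆ A`, its sums over `oedges A` and `oedges D` agree. [folklore] -/
theorem sum_oedges_eq_sum_oedges_of_subset {M : Type*} [AddCommMonoid M] {D A : Finset (Site d)} (hDA : D ⊆ A)
    (g : Site d × Fin d → M) (hg : ∀ p, p.1 ∉ D → p.1 + uvec p.2 ∉ D → g p = 0) :
    ∑ p ∈ oedges A, g p = ∑ p ∈ oedges D, g p := by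
  symm
  refine sum_subset (oedges_mono hDA) fun p _ hpD => ?_
  rw [mem_oedges, not_or] at hpD
  exact hg p hpD.1 hpD.2

/-- Translating an oriented edge set: `(x, i) ↦ (x - v, i)` maps `oedges X` onto `oedges (X - v)`.
[folklore] -/
theorem mem_oedges_image_sub_iff {X : Finset (Site d)} (v : Site d) {p : Site d × Fin d} :
    p ∈ oedges (X.image fun y => y - v) ↔ (p.1 + v, p.2) ∈ oedges X := by
  rw [mem_oedges, mem_oedges]
  simp only [mem_image]
  constructor
  · rintro (⟨y, hy, hyp⟩ | ⟨y, hy, hyp⟩)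
    · left; rwa [← hyp, sub_add_cancel]
    · right; rw [add_right_comm, ← hyp, sub_add_cancel]; exact hy
  · rintro (h | h)
    · exact Or.inl ⟨p.1 + v, h, by rw [add_sub_cancel_right]⟩
    · exact Or.inr ⟨p.1 + uvec p.2 + v, by rwa [add_right_comm], by rw [add_sub_cancel_right]⟩

end Literature.Probability.LatticeModels

end
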